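import Summits.CriticalPhenomena.PercolationContinuityZ3.Theorems.PercNearOneGluingNoHeavyLowerTailSahiTwoLevelC3
import Summits.CriticalPhenomena.PercolationContinuityZ3.Theorems.SahiMasterFamilyFibreCubic

/-!
# Sahi's `C_3` on product measures from ONE GOOD AXIS: the sectional defect of the fibre cubic,
# its two-level form, and the existential rung `SahiGoodAxis ⟹ Kahn's Conjecture 5`

Support file of the one-cut programme (crux `NoHeavyLowerTail`, stmt-CriticalPhenomena-4575; cell `prim-bnk`, seat bnk-2 gen 11,
memo `run/shared/lean/prim/prim-l12/FROM-prim-bnk-2-g11-GOOD-AXIS.md`; INEQ-CLAIMS rows GA / SA / COMB-M-E3).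

Along a coordinate `a` of a product measure `μ_q` the function `x ↦ Φ_a(x) = E_3(μ_{q[a ↦ x]}; 1_{U_0},1_{U_1},1_{U_2})` is the
fibre cubic `cubicE3` (`…SahiMasterFamilyCommonPivotal`); `Φ_a(q_a) = E_3(μ_q; 1_U)`, `Φ_a(1)` / `Φ_a(0)` are `E_3` of the
`1`- / `0`-sections (`SahiLogDerivEnd.cubicE3_zero_eq_secAt`, `FibreCubic.cubicE3_one_eq_secAt`).  The **sectional defect** along `a` is
  `Δ_a(U) := Φ_a(q_a) − [q_a Φ_a(1) + (1 − q_a) Φ_a(0)] = E_3(U) − E_{x_a}[E_3(U | x_a)]`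
(the cubic above its chord at the actual parameter).  Two facts and one conjecture:
* `sectionalDefect_eq_twoLevel` — **`Δ_a = q_a(1−q_a)·N_a`** with
  **`N_a = twoLevelForm μ_q G H − q_a·∏_i (μ_q(G_i) − μ_q(H_i)) − E_3(G) − E_3(H)`**, `G = U^{a←1}`, `H = U^{a←0}`
  (`twoLevelForm` of `…SahiTwoLevelC3`; equivalently `N_a = (1−q_a)·BOTTOM + q_a·TOP − E_3(G) − E_3(H)` with BOTTOM `= 3β₁ − β₀`,
  TOP `= 3β₂ − β₃` the two endpoint letters of the lane's ladder).  In section moments (memo §1):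
  `N_a = Σ_c δ_c·[Cov(G_a',G_b') − Cov(H_a',H_b')] + Σ_c μ(U_c)·δ_a'δ_b' + (2 − 4q_a)·δ₀δ₁δ₂` (`δ_c = μ(G_c) − μ(H_c)` the influences),
  and at `q ≡ 1/2` the axis-sum `Σ_a q(1−q)N_a = ¼[⟨A,BC⟩ + ⟨B,AC⟩ + ⟨C,AB⟩ − μ(A)⟨B,C⟩ − μ(B)⟨A,C⟩ − μ(C)⟨A,B⟩]` with the
  influence inner product `⟨X,Y⟩ = Σ_a I_a(X)I_a(Y)`.
* **CONJECTURE GA (`SahiGoodAxis`, new, OPEN)**: every triple of increasing events determined by a nonempty set `S` of coordinates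
  has a coordinate `a ∈ S` with `Δ_a ≥ 0` (along SOME axis `E_3` is at least the average of its two sectional values).
  **`masterFamilyNonneg_three_of_goodAxis` / `kahnConjecture_of_goodAxis`: GA ⟹ `MasterFamilyNonneg 3` ⟺ Kahn's Conjecture 5**
  (induction on the determining set: `E_3(U) ≥ q_aE_3(U^{a←1}) + (1−q_a)E_3(U^{a←0}) ≥ 0`).  GA is the first EXISTENTIAL
  (instance-adaptive) rung of the ladder; its universal version SA (`Σ_a Δ_a ≥ 0`, uniform axis weights) is FALSE from `n = 5`
  (exhaustive, addendum below; the first witness found, at `n = 6`: `U_0 = U_1 = x_1 ∨ P`, `U_2 = P`, `P = x_0x_2x_3x_4x_5`, uniform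
  measure: `E_3 = 2945/131072 <` the axis-average of the sectional means `= 3001/131072`; at `n = 5`: `U = (x_0∨x_1∨x_2,
  x_4(x_0∨x_1∨x_2∨x_3), x_3(x_0∨x_1∨x_2∨x_4))`, `E_3 = 7/8192`, axis defects `(−20,−20,−20,28,28)/2¹⁵`), which also shows that the
  Bonami–Beckner noise-operator interpolation
  `Φ(ρ) = 2μ(ABC) + E[T_σA·T_σB·T_σC] − Σ_cyc E[A·T_ρ(BC)]` (`σ² = ρ`; `Φ(1) = 0`, `Φ(0) = E_3`; `= Σ_K ρ^{|K|}(1−ρ)^{n−|K|}·`(mean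
  sectional `E_3` over the coordinates `K`)) is NOT monotone in general — the semigroup proof of Harris' inequality does not extend to
  `E_3` (memo §3).  The degree-4 analogue of GA (for Sahi's `E_4`) is FALSE already at `n = 3` (`U_i = x_0 ∨ x_1 ∨ x_2`, memo §4).
  CENSUS of GA (memo §2; C engines `goodaxis.c` / `gastrict.c` / `thresholds.py` with exact rationals for the symmetric family):
  `n ≤ 4` EXHAUSTIVE over all up-set triples × 44 product measures (3.4·10⁷ (triple, q) pairs; whenever every axis is used by ≥ 2 of
  the events a STRICTLY good axis exists), `n = 5, 6, 7` simulated annealing minimising `max_a N_a` over (triples, q)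
  (9.6·10⁷ / 3.3·10⁷ / 9.5·10⁶ evaluations), all `S_n`-symmetric (threshold) triples for `n ≤ 24` at 7 values of `q` (122 850 triples,
  exact), cyclically invariant families `n ≤ 13` (83 600 triples), tribes / dual tribes / thresholds at `n = 12` (29 640): `0` violations.
  ADDENDUM (same gen, engine `gaexh5.c`, exact integer arithmetic): **`n = 5` EXHAUSTIVE at `q ∈ {1/2, 1/3, 2/3, 1/5}`** — every unordered
  triple of nontrivial up-sets of `{0,1}^5` up to `S_5` (first event over the 208 orbit representatives × all pairs; 5.97·10⁹ triple tests
  per `q`): **GA violations `0`** at all four `q` (at `q = 1/2`: 3.5·10⁴ hits with exactly one good axis, none with zero; minimum over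
  all-shared triples of `max_a Δ_a / E_3` = `0.0029` at `(OR_5)³`); the axis-SUM SA fails at `n = 5` for all four `q` (5 / 15 / 577 / 37
  hits).  A FORCED coordinate (`U_0 ⊆ {ω | a ∈ ω}`) is always a good axis: `…SahiGoodAxisForced` (`chord_le_cubicE3_of_forced`).
Everything below is proved; axioms standard; GA, `SahiTwoLevelPlus` and `C_3` remain OPEN (obligations, never facts). [this work]
-/

noncomputable section

open scoped Classical

namespace Summit.CriticalPhenomena.PercolationContinuityZ3.Theorems

open Finset Function
open Literature.Combinatorics.Sahi2008
open Literature.Probability.LatticeModels (prodBernoulli)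
open Literature.Probability.Percolation (DeterminedBy determinedBy_iff)
open Literature.Probability.Percolation.DecisionTree (ind ind_of_mem ind_of_not_mem ind_nonneg)
open SahiComb SahiLogDerivEnd SahiTwoLevel

namespace SahiGoodAxis

/-! ### The sectional defect of the fibre cubic -/

section Cubic

variable {κ : Type*} [Fintype κ]

/-- The fibre cubic at the actual parameter `q_a` is `E_3(μ_q; 1_U)` itself. [this work] -/
theorem cubicE3_self_eq (q : κ → unitInterval) (a : κ) (U : Fin 3 → Set (Set κ)) :
    cubicE3 q a (ind (U 0)) (ind (U 1)) (ind (U 2)) (q a) = sahiE (bernoulliWeight q) 3 (fun j => ind (U j)) := by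
  rw [← sahiE_three_ind_update_eq, update_eq_self]

/-- **The sectional defect** of a triple of events along the coordinate `a` under `μ_q`:
`Δ_a(U) = Φ_a(q_a) − [q_a·Φ_a(1) + (1 − q_a)·Φ_a(0)]` — `E_3(U)` minus the `x_a`-average of `E_3` of the two sections. [this work] -/
def sectionalDefect (q : κ → unitInterval) (a : κ) (U : Fin 3 → Set (Set κ)) : ℝ :=
  cubicE3 q a (ind (U 0)) (ind (U 1)) (ind (U 2)) (q a)
    - ((q a : ℝ) * cubicE3 q a (ind (U 0)) (ind (U 1)) (ind (U 2)) 1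
        + (1 - (q a : ℝ)) * cubicE3 q a (ind (U 0)) (ind (U 1)) (ind (U 2)) 0)

/-- **The defect in terms of `E_3` of the triple and of its sections**:
`Δ_a(U) = E_3(μ_q; 1_U) − [q_a·E_3(μ_q; 1_{U^{a←1}}) + (1−q_a)·E_3(μ_q; 1_{U^{a←0}})]`. [this work] -/
theorem sectionalDefect_eq_sahiE (q : κ → unitInterval) (a : κ) (U : Fin 3 → Set (Set κ)) :
    sectionalDefect q a U = sahiE (bernoulliWeight q) 3 (fun j => ind (U j))
      - ((q a : ℝ) * sahiE (bernoulliWeight q) 3 (fun j => ind (secAt a true (U j)))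
          + (1 - (q a : ℝ)) * sahiE (bernoulliWeight q) 3 (fun j => ind (secAt a false (U j)))) := by
  rw [sectionalDefect, cubicE3_self_eq, FibreCubic.cubicE3_one_eq_secAt, cubicE3_zero_eq_secAt]

/-- **THE DEFECT IS `q_a(1−q_a)` TIMES A TWO-LEVEL FORM**: with `G = U^{a←1}`, `H = U^{a←0}` (nested increasing sections),
`Δ_a(U) = q_a(1−q_a)·[twoLevelForm μ_q G H − q_a·∏_i (μ_q(G_i) − μ_q(H_i)) − E_3(μ_q;1_G) − E_3(μ_q;1_H)]`, i.e.
`N_a = (1−q_a)·(3β₁−β₀) + q_a·(3β₂−β₃) − β₀ − β₃` in the Bernstein coefficients of the fibre cubic.  (Pure cubic algebra: for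
`Φ(x) = Φ(0) + Φ′(0)x + c₂x² + c₃x³`, `Φ(q) − qΦ(1) − (1−q)Φ(0) = −q(1−q)(c₂ + (1+q)c₃)` and `twoLevelForm(G,H) = 2Φ(0) + Φ′(0)`,
`∏δ = c₃`.) [this work] -/
theorem sectionalDefect_eq_twoLevel (q : κ → unitInterval) (a : κ) (U : Fin 3 → Set (Set κ)) :
    sectionalDefect q a U = (q a : ℝ) * (1 - (q a : ℝ)) *
      (twoLevelForm (fun A => (prodBernoulli q).real A) (fun i => secAt a true (U i)) (fun i => secAt a false (U i))
        - (q a : ℝ) * ∏ i, ((prodBernoulli q).real (secAt a true (U i)) - (prodBernoulli q).real (secAt a false (U i)))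
        - sahiE (bernoulliWeight q) 3 (fun j => ind (secAt a true (U j)))
        - sahiE (bernoulliWeight q) 3 (fun j => ind (secAt a false (U j)))) := by
  rw [twoLevelForm_secAt_eq', ← FibreCubic.cubicE3_one_eq_secAt, ← cubicE3_zero_eq_secAt, sectionalDefect]
  have hsec : ∀ (i : Fin 3) (b : Bool), (prodBernoulli q).real (secAt a b (U i)) = secEx q a (ind (U i)) b := by
    intro i b
    rw [secEx_ind_eq_ex_secAt, ex_bernoulliWeight_ind]
  simp only [hsec, Fin.prod_univ_three]
  simp only [cubicE3, derivE3AtZero]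
  ring

end Cubic

/-! ### The conjecture and the induction -/

/-- **Conjecture GA (ONE GOOD AXIS)** (bnk-2 gen 11; INEQ-CLAIMS row GA): for every finite cube, every product measure `μ_q`, every
triple of increasing events and every NONEMPTY set `S` of coordinates determining the three events, SOME coordinate `a ∈ S` has
nonnegative sectional defect: `q_a·Φ_a(1) + (1−q_a)·Φ_a(0) ≤ Φ_a(q_a)`, i.e. `E_3(U) ≥ q_a E_3(U^{a←1}) + (1−q_a) E_3(U^{a←0})`
(equivalently `N_a = (1−q_a)·BOTTOM_a + q_a·TOP_a − E_3(U^{a←1}) − E_3(U^{a←0}) ≥ 0`, `sectionalDefect_eq_twoLevel`).  A coordinate on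
which at most one of the events depends has defect `0`, so the content is an axis shared by two or three of the events.  Its universal
('every axis' or 'axis-average') versions are FALSE (file header); the degree-4 analogue is false.  Census: file header / memo §2.
Implies `C_3` on product measures (`masterFamilyNonneg_three_of_goodAxis`).  OPEN; an obligation of our theories, never a fact.
[this work] [status: open] -/
@[conjecture] def GoodAxis : Prop :=
  ∀ (κ : Type) [Fintype κ] (q : κ → unitInterval) (U : Fin 3 → Set (Set κ)), (∀ i, IsUpperSet (U i)) →
    ∀ S : Finset κ, S.Nonempty → (∀ i, DeterminedBy (U i) (↑S : Set κ)) →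
      ∃ a ∈ S, (q a : ℝ) * cubicE3 q a (ind (U 0)) (ind (U 1)) (ind (U 2)) 1
          + (1 - (q a : ℝ)) * cubicE3 q a (ind (U 0)) (ind (U 1)) (ind (U 2)) 0
        ≤ cubicE3 q a (ind (U 0)) (ind (U 1)) (ind (U 2)) (q a)

/-- `GoodAxis` says exactly: some `a ∈ S` has `0 ≤ sectionalDefect q a U`. [this work] -/
theorem goodAxis_iff : GoodAxis ↔
    ∀ (κ : Type) [Fintype κ] (q : κ → unitInterval) (U : Fin 3 → Set (Set κ)), (∀ i, IsUpperSet (U i)) →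
      ∀ S : Finset κ, S.Nonempty → (∀ i, DeterminedBy (U i) (↑S : Set κ)) → ∃ a ∈ S, 0 ≤ sectionalDefect q a U := by
  simp only [GoodAxis, sectionalDefect, sub_nonneg]

section Induction

variable {κ : Type} [Fintype κ]

/-- **The induction on a determining set**: under `GoodAxis`, every triple of increasing events determined by a finite set `S` has
`E_3(μ_q; 1_U) ≥ 0` for every product measure `q`.  Step: pick the good `a ∈ S`; both sections are increasing and determined by
`S ∖ {a}`, so `E_3(U) ≥ q_a E_3(U^{a←1}) + (1−q_a) E_3(U^{a←0}) ≥ 0`. [this work] -/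
theorem sahiE_three_nonneg_of_determinedBy (hGA : GoodAxis) :
    ∀ (n : ℕ) (S : Finset κ), S.card ≤ n → ∀ (U : Fin 3 → Set (Set κ)), (∀ i, IsUpperSet (U i)) →
      (∀ i, DeterminedBy (U i) (↑S : Set κ)) → ∀ q : κ → unitInterval, 0 ≤ sahiE (bernoulliWeight q) 3 (fun i => ind (U i)) := by
  intro n
  induction n with
  | zero =>
    intro S hS U _ hUd q
    have hS0 : S = ∅ := Finset.card_eq_zero.1 (Nat.le_zero.1 hS)
    subst hS0
    rw [sahiE_bernoulliWeight_eq_sum_combCoeff]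
    exact sum_nonneg fun j _ => mul_nonneg
      (combCoeff_ind_nonneg_of_trivial U (fun i => eq_empty_or_univ_of_determinedBy_empty (hUd i)) j) (bern_nonneg _ _ _)
  | succ n ih =>
    intro S hS U hU hUd q
    by_cases hne : S.Nonempty
    · obtain ⟨a, haS, hgood⟩ := hGA κ q U hU S hne hUd
      have hcard : (S.erase a).card ≤ n := by
        rw [card_erase_of_mem haS]
        omega
      have hsec : ∀ (b : Bool) (i : Fin 3), DeterminedBy (secAt a b (U i)) (↑(S.erase a) : Set κ) :=
        fun b i => determinedBy_secAt a b (hUd i)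
      have h1 : 0 ≤ cubicE3 q a (ind (U 0)) (ind (U 1)) (ind (U 2)) 1 := by
        rw [FibreCubic.cubicE3_one_eq_secAt]
        exact ih (S.erase a) hcard _ (fun i => isUpperSet_secAt a true (hU i)) (hsec true) q
      have h0 : 0 ≤ cubicE3 q a (ind (U 0)) (ind (U 1)) (ind (U 2)) 0 := by
        rw [cubicE3_zero_eq_secAt]
        exact ih (S.erase a) hcard _ (fun i => isUpperSet_secAt a false (hU i)) (hsec false) q
      have hq0 : 0 ≤ (q a : ℝ) := (q a).2.1
      have hq1 : (q a : ℝ) ≤ 1 := (q a).2.2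
      rw [← cubicE3_self_eq q a U]
      refine le_trans ?_ hgood
      exact add_nonneg (mul_nonneg hq0 h1) (mul_nonneg (sub_nonneg.2 hq1) h0)
    · have hS0 : S = ∅ := Finset.not_nonempty_iff_eq_empty.1 hne
      subst hS0
      exact ih ∅ (by simp) U hU hUd q

end Induction

end SahiGoodAxis

open SahiGoodAxis

/-- **ONE GOOD AXIS IMPLIES SAHI'S `C_3` ON PRODUCT MEASURES.**  If every triple of increasing events on every finite cube has, in
every nonempty determining set of coordinates, a coordinate along which `E_3` is at least the average of its two sectional values
(`SahiGoodAxis.GoodAxis`), then `MasterFamilyNonneg 3` (Kahn's Conjecture 5). [this work] -/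
theorem masterFamilyNonneg_three_of_goodAxis (hGA : GoodAxis) : MasterFamilyNonneg 3 := by
  intro ι _ p U hU
  exact sahiE_three_nonneg_of_determinedBy hGA (Finset.univ : Finset ι).card Finset.univ le_rfl U hU
    (fun j => determinedBy_coe_univ _) p

/-- **One good axis ⟹ Kahn's Conjecture 5.** [this work] -/
theorem kahnConjecture_of_goodAxis (hGA : GoodAxis) : KahnConjecture :=
  masterFamilyNonneg_three_iff_kahnConjecture.1 (masterFamilyNonneg_three_of_goodAxis hGA)

/-- **One good axis ⟹ `C_3` for DECREASING triples** (order duality; the percolation separation rows are down-sets). [this work] -/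
theorem masterFamilyNonnegLower_three_of_goodAxis (hGA : GoodAxis) : MasterFamilyNonnegLower 3 :=
  (masterFamilyNonnegLower_iff 3).2 (masterFamilyNonneg_three_of_goodAxis hGA)

end Summit.CriticalPhenomena.PercolationContinuityZ3.Theorems
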